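import Summits.HubbardSuperconductivity.HubbardSuperconductivity.Theorems.AnisotropyChordKnnAllNBounds

/-!
# Route `AnisotropyChord` / H0 rotor rung, K_{n,n} sibling of XY-LM₀: **LEMMA C for ALL `n ≥ 8` — the budget condition
# (S_M) for every `M + 4 ≤ n` and every `0 < η ≤ 1`, hence `XYLiebMattisKnn n Δ` for all `n ≥ 8`, `0 ≤ Δ < 1`**
(prover seat `hubbard-h0-rotor-p1` g16; the analytic all-`n` half of the Lean proof of the theory seat's THEOREM Q⁺ —
memo ROTOR-THEORY-11 §168 proved it on paper with machine certificates; this is a different, certificate-light proof)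

With the ratio bounds of `…KnnAllNBounds` (`T_k = ¼`, `T_top = 4/25`; `ratio_hypotheses`) the Horner value of
`budgetCondition_of_ratioBounds` is controlled by the invariant `H_k ≤ 29·d_k` (adjacent diagonal drops differ by `≤ 13`,
coupling drops are `≤ ⅔` of the diagonal drop, `1 + 13(⅓ + 29/16) ≤ 29`; base `H_0 ≤ 2 d_0` including the vanished
level), refined on the last link below the budget level (`ρ ≤ 7/2` ⇒ `H ≤ (817/96)·D`), and finally
`H_top ≤ (1/5 + 2·(27/80)·(4/25) + (4/25)²·(817/96))·D = (1972/3750)·D ≤ D = budget`.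
-/

set_option linter.dupNamespace false
set_option autoImplicit false

noncomputable section

open Finset Matrix

namespace Summit.HubbardSuperconductivity.HubbardSuperconductivity.Theorems.AnisotropyChord.Knn

/-! ## The Horner value -/

/-- base of the Horner recursion: `H_0 ≤ 2 d_0`. [folklore] -/
theorem horner_zero_le {n M : ℕ} (hM : M + 4 ≤ n) {η : ℝ} (h0 : 0 ≤ η) :
    horner (dK n M η) (dcUK n M η) (cUK n (M : ℤ) η) (ratioTall (numLevels n (M : ℤ))) (shift n M) 0
      ≤ 2 * dK n M η 0 := by
  rw [horner_zero]
  have hd := dK_nonneg n M h0 0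
  split_ifs with hs
  · have h1 := cUK_zero_le_of_shift n M h0 hM hs
    have hT := ratioTall_le (numLevels n (M : ℤ)) 0
    have hc := cUK_nonneg n (M : ℤ) h0 0
    nlinarith [mul_le_mul h1 hT.2 hT.1 (by linarith)]
  · linarith

/-- **Horner invariant:** `H_{k'} ≤ 29 · d_{k'}` for every level at least two below the top of sector `M+1`. [folklore] -/
theorem horner_le_inv {n M : ℕ} (_hn : 8 ≤ n) (hM : M + 4 ≤ n) {η : ℝ} (h0 : 0 ≤ η) :
    ∀ k', k' + 2 ≤ numLevels n ((M : ℤ) + 1) - 1 →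
      horner (dK n M η) (dcUK n M η) (cUK n (M : ℤ) η) (ratioTall (numLevels n (M : ℤ))) (shift n M) k'
        ≤ 29 * dK n M η k' := by
  set t := numLevels n ((M : ℤ) + 1) - 1 with ht
  have hN : numLevels n (M : ℤ) = numLevels n ((M : ℤ) + 1) + shift n M := numLevels_succ n M (by omega)
  have hM1abs : ((M : ℤ) + 1).natAbs ≤ n := by rw [natAbs_natCast_succ]; omega
  have hNpos := numLevels_pos n ((M : ℤ) + 1)
  intro k'
  induction k' with
  | zero =>
    intro _
    have := horner_zero_le hM h0 (n := n)
    have hd := dK_nonneg n M h0 0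
    linarith
  | succ k' ih =>
    intro hk'
    have ih' := ih (by omega)
    rw [horner_succ]
    have hT : ratioTall (numLevels n (M : ℤ)) (k' + shift n M) = 1 / 4 := by
      unfold ratioTall; rw [if_pos (by omega)]
    rw [hT]
    have hl := lev_add_twice_sub n hM1abs (k := k') (by omega)
    have hl1 := lev_add_twice_sub n hM1abs (k := k' + 1) (by omega)
    rw [← ht] at hl hl1
    have hJ1 := succ_le_lev_succM n M k'
    have hdc := dcUK_le_dK n M h0 k' (by omega)
    -- d_{k'} ≤ 13 d_{k'+1}
    have hrho : dK n M η k' ≤ 13 * dK n M η (k' + 1) := by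
      rw [dK_eq_of_le n M η k' (by omega), dK_eq_of_le n M η (k' + 1) (by omega)]
      have e : lev n ((M : ℤ) + 1) (k' + 1) = lev n ((M : ℤ) + 1) k' + 2 := by unfold lev; ring
      rw [e, show lev n ((M : ℤ) + 1) k' + 2 - 1 = lev n ((M : ℤ) + 1) k' + 1 by omega]
      have hr := rho_le (n := n) (J := lev n ((M : ℤ) + 1) k') (by omega) (by omega)
      have hfac : 0 ≤ η / 4 * (2 * (M : ℝ) + 1) := by positivity
      nlinarith [mul_le_mul_of_nonneg_left hr hfac]
    have hd1 := dK_nonneg n M h0 (k' + 1)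
    nlinarith

/-- the last link below the budget level: `H_{t−1} ≤ (817/96) · d_{t−1}`. [folklore] -/
theorem horner_pred_top_le {n M : ℕ} (hn : 8 ≤ n) (hM : M + 4 ≤ n) {η : ℝ} (h0 : 0 ≤ η) :
    horner (dK n M η) (dcUK n M η) (cUK n (M : ℤ) η) (ratioTall (numLevels n (M : ℤ))) (shift n M)
        (numLevels n ((M : ℤ) + 1) - 1 - 1)
      ≤ 817 / 96 * dK n M η (numLevels n ((M : ℤ) + 1) - 1 - 1) := by
  set t := numLevels n ((M : ℤ) + 1) - 1 with ht
  have hN : numLevels n (M : ℤ) = numLevels n ((M : ℤ) + 1) + shift n M := numLevels_succ n M (by omega)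
  have hM1abs : ((M : ℤ) + 1).natAbs ≤ n := by rw [natAbs_natCast_succ]; omega
  have hNpos := numLevels_pos n ((M : ℤ) + 1)
  -- t ≥ 1 (levels n − 2 and n belong to sector M + 1)
  have ht1 : 1 ≤ t := by
    have hl := lev_add_twice_sub n hM1abs (k := 0) (by omega)
    have hj := jMin_le_natAbs_succ n ((M : ℤ) + 1)
    rw [natAbs_natCast_succ] at hj
    unfold lev at hl; omega
  rcases Nat.lt_or_ge t 2 with ht2 | ht2
  · -- t = 1
    have : t - 1 = 0 := by omega
    rw [this]
    have := horner_zero_le hM h0 (n := n)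
    have hd := dK_nonneg n M h0 0
    linarith
  · obtain ⟨j, hj⟩ : ∃ j, t - 1 = j + 1 := ⟨t - 2, by omega⟩
    rw [hj, horner_succ]
    have hT : ratioTall (numLevels n (M : ℤ)) (j + shift n M) = 1 / 4 := by
      unfold ratioTall; rw [if_pos (by omega)]
    rw [hT]
    have hA := horner_le_inv hn hM h0 j (by omega)
    have hlj := lev_add_twice_sub n hM1abs (k := j) (by omega)
    have hlj1 := lev_add_twice_sub n hM1abs (k := j + 1) (by omega)
    rw [← ht] at hlj hlj1
    have hdc := dcUK_le_dK n M h0 j (by omega)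
    -- d_{t−2} ≤ (7/2) d_{t−1}
    have hrho : dK n M η j ≤ 7 / 2 * dK n M η (j + 1) := by
      rw [dK_eq_of_le n M η j (by omega), dK_eq_of_le n M η (j + 1) (by omega)]
      rw [show lev n ((M : ℤ) + 1) j = n - 4 by omega, show lev n ((M : ℤ) + 1) (j + 1) = n - 2 by omega,
        show n - 4 - 1 = n - 5 by omega, show n - 2 - 1 = n - 3 by omega]
      have hr := rhoTop_le (n := n) hn
      have hfac : 0 ≤ η / 4 * (2 * (M : ℝ) + 1) := by positivity
      nlinarith [mul_le_mul_of_nonneg_left hr hfac]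
    have hd1 := dK_nonneg n M h0 (j + 1)
    nlinarith

/-- **the Horner value is at most the budget** (`n ≥ 8`, `M + 4 ≤ n`, `0 ≤ η`). [folklore] -/
theorem horner_top_le_budget {n M : ℕ} (hn : 8 ≤ n) (hM : M + 4 ≤ n) {η : ℝ} (h0 : 0 ≤ η) :
    horner (dK n M η) (dcUK n M η) (cUK n (M : ℤ) η) (ratioTall (numLevels n (M : ℤ))) (shift n M)
        (numLevels n ((M : ℤ) + 1) - 1)
      ≤ budget n M η := by
  set t := numLevels n ((M : ℤ) + 1) - 1 with ht
  have hN : numLevels n (M : ℤ) = numLevels n ((M : ℤ) + 1) + shift n M := numLevels_succ n M (by omega)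
  have hM1abs : ((M : ℤ) + 1).natAbs ≤ n := by rw [natAbs_natCast_succ]; omega
  have hNpos := numLevels_pos n ((M : ℤ) + 1)
  have ht1 : 1 ≤ t := by
    have hl := lev_add_twice_sub n hM1abs (k := 0) (by omega)
    have hj := jMin_le_natAbs_succ n ((M : ℤ) + 1)
    rw [natAbs_natCast_succ] at hj
    unfold lev at hl; omega
  obtain ⟨j, hj⟩ : ∃ j, t = j + 1 := ⟨t - 1, by omega⟩
  have hB := horner_pred_top_le hn hM h0 (n := n) (M := M) (η := η)
  rw [← ht, hj, show j + 1 - 1 = j by omega] at hB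
  rw [hj, horner_succ]
  have hT : ratioTall (numLevels n (M : ℤ)) (j + shift n M) = 4 / 25 := by
    unfold ratioTall; rw [if_neg (by omega)]
  rw [hT]
  have hlj : lev n ((M : ℤ) + 1) j = n - 2 := by
    have := lev_add_twice_sub n hM1abs (k := j) (by omega); rw [← ht] at this; omega
  have hbud : dK n M η j = budget n M η := dK_budget_eq n M η hM j hlj
  have htop : dK n M η (j + 1) ≤ 1 / 5 * budget n M η := by
    rw [show j + 1 = numLevels n ((M : ℤ) + 1) - 1 by omega, dK_top_eq n M η (by omega)]
    unfold budget
    have hd := dTop_le (n := n) (by omega)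
    have hfac : 0 ≤ η / 4 * (2 * (M : ℝ) + 1) := by positivity
    nlinarith [mul_le_mul_of_nonneg_left hd hfac]
  have hdc := dcUK_top_le n M h0 hM j hlj
  rw [hbud] at hB hdc
  have hbud0 : 0 ≤ budget n M η := by rw [← hbud]; exact dK_nonneg n M h0 j
  nlinarith

/-! ## LEMMA C and THEOREM Q⁺ for `n ≥ 8` -/

/-- **LEMMA C (all `n ≥ 8`), Lean:** the budget condition (S_M) holds for every `n ≥ 8`, every `M + 4 ≤ n` and every
real `0 < η ≤ 1`. [conjecture: theory seat hubbard-h0-rotor-theory-1, cycle 12 — LEMMA C (memo §167/§168, paper + machine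
certificates); independent Lean proof here by the ratio majorant] -/
theorem budgetCondition_of_ge_eight {n M : ℕ} (hn : 8 ≤ n) (hM : M + 4 ≤ n) {η : ℝ} (h0 : 0 < η) (h1 : η ≤ 1) :
    BudgetCondition n M η :=
  budgetCondition_of_ratioBounds hM h0 (ratioTall (numLevels n (M : ℤ)))
    (fun k hk => (ratio_hypotheses hn hM h0 h1 k hk).1) (fun k hk => (ratio_hypotheses hn hM h0 h1 k hk).2)
    (horner_top_le_budget hn hM h0.le)

/-- **THEOREM Q⁺ for `n ≥ 8`, Lean: `XYLiebMattisKnn n Δ` for every `n ≥ 8` and every `0 ≤ Δ < 1`** — XY-Lieb–Mattis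
ordering of the sector ground states of the two-big-spin block of the spin-½ XXZ model on `K_{n,n}`. Not a statement
about tori or the Hubbard model. [conjecture: theory seat hubbard-h0-rotor-theory-1, cycle 12 — THEOREM Q⁺ (M20); Lean
proof here] -/
theorem xyLiebMattisKnn_of_ge_eight {n : ℕ} (hn : 8 ≤ n) {Δ : ℝ} (h0 : 0 ≤ Δ) (h1 : Δ < 1) : XYLiebMattisKnn n Δ :=
  xyLiebMattisKnn_of_budgets h1 fun _ hM => budgetCondition_of_ge_eight hn hM (by linarith) (by linarith)

end Summit.HubbardSuperconductivity.HubbardSuperconductivity.Theorems.AnisotropyChord.Knn
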